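import Mathlib
import HarnessLib
import Literature.MathematicalPhysics.StatisticalMechanics.AbkmPackageShrink
import Literature.MathematicalPhysics.StatisticalMechanics.TorusFRDStepKernelPair

/-!
# [ABKM19] package plumbing: the step kernels `𝒞_{1+q,k+1}` of a package carry `StepKernelBounds`
# (Theorem 7.1 (w6)–(w7) relative to the `q = 0` weights) and make admissible activities `C^{r₀}`-integrable

Literature-side twins of the Summits-side `packageAt_stepKernelBounds` (route ComplexGFFStiffness, g14), so that the
package-level two-kernel files (`AbkmPackageOpCTwoKernel`, `AbkmPackageNextHTwoKernel`, and the remainder twins to come)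
can quote ONE lemma instead of the 19-argument `stepKernelBounds_family_of_torusFRD`:

* `PackageAt.stepKernelBounds_kernels` — for `q` in the tuning ball and `k + 1 ≤ N`, `StepKernelBounds` of
  `Q.kernels q (k+1)` with the `N`-free integration constant `P.A𝒫'` and `C₂ = secondDiffConst (P.Cα · 0)`;
* `PackageAt.contDiff_fluct_kernels` — `ξ ↦ ∫ K(X, φ + ξ) μ_{𝒞_{1+q,k+1}}(dξ)` is `C^{r₀}` in `φ` for an activity with
  `‖K‖_k ≤ C` on every connected `k`-polymer `X` (Lemma 8.4).

Everything is proved; no named fact.  Honest scope: plumbing for the rung route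
`Summits/HubbardSuperconductivity/…/Theses/ComplexGFFStiffness`; nothing about superconductivity in the Hubbard model.

## References
* S. Adams, S. Buchholz, R. Kotecký, S. Müller, arXiv:1910.13564 — Theorem 7.1 (w6)–(w7), Lemma 8.4
  [AdamsBuchholzKoteckyMuller2019].
-/

noncomputable section

namespace Literature.MathematicalPhysics.StatisticalMechanics.GradientRG

open Literature.MathematicalPhysics.StatisticalMechanics.TorusPolymer (IsPolymer)
open Literature.Barriers.CriticalPhenomena.LongRangePhi4.Polymer (IsConn)

variable {d : ℕ}

namespace PackageAt

variable {P : PackageData d} {N M : ℕ} [NeZero M] (Q : PackageAt P N M)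

/-- **The step kernels of a package on the tuning ball carry `StepKernelBounds`** with the `N`-free integration
constant `A_𝒫'` of the package (Theorem 7.1 (w6)–(w7) for `𝒞_{1+q,k+1}`, dominated by `(1+θ)𝒞_{1,k+1}` shell-wise).
[cite: AdamsBuchholzKoteckyMuller2019, Theorem 7.1 (w6)–(w7)] -/
theorem stepKernelBounds_kernels {q : Matrix (Fin d) (Fin d) ℝ} (hq : P.InBall q) {k : ℕ} (hk : k + 1 ≤ N) :
    StepKernelBounds (abkmWeightData P.L N P.Mord P.R P.θbar (schedDelta P.δ₀ P.δ₁ N) fun j => Q.𝒞 1 j) P.L k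
      P.A𝒫' (secondDiffConst fun θ' => P.Cα θ' 0) (Q.kernels q (k + 1)) := by
  have h := stepKernelBounds_family_of_torusFRD P.hd P.hMord P.hMR P.hLodd P.hL P.hθbar P.hlam P.hn P.hn2 P.hnñ
    P.hc P.hC1 Q.hallA Q.hB P.hθ0 P.hθ P.hT₀ P.hKT₀ hq.1 hq.2 k hk
  rw [P.hA𝒫'] at h
  exact h

/-- **`R^{(q)}_{k+1}K(X)` is `C^{r₀}`** for an activity with `‖K‖_k^{(A)} ≤ C` (`C ≥ 0`) on every connected `k`-polymer `X`,
`q` in the tuning ball, `k + 1 ≤ N` (Lemma 8.4 with the package's step kernel).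
[cite: AdamsBuchholzKoteckyMuller2019, Lemma 8.4] -/
theorem contDiff_fluct_kernels {q : Matrix (Fin d) (Fin d) ℝ} (hq : P.InBall q) {k : ℕ} (hk : k + 1 ≤ N)
    {K : Finset (Fin d → ZMod M) → ((Fin d → ZMod M) → ℝ) → ℂ} {C : ℝ} (hC : 0 ≤ C)
    (hK : WeakNormLE Q.normParams k K C) (hKd : ∀ X, ContDiff ℝ P.r₀ (K X))
    (hKloc : ∀ X, IsPolymer (P.L ^ k) X → IsConn X → IsGaugeLocal (Q.normParams.gauge k X) (K X))
    {X : Finset (Fin d → ZMod M)} (hX : IsPolymer (P.L ^ k) X) (hc : IsConn X) :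
    ContDiff ℝ P.r₀ (fluct (Q.kernels q (k + 1)) (K X)) :=
  contDiff_fluct_of_weakNormLE_of_stepKernelBounds (p := P.pT) Q.hB (Q.stepKernelBounds_kernels hq hk) P.A_pos hC hK
    hKd hKloc hX hc

end PackageAt

end Literature.MathematicalPhysics.StatisticalMechanics.GradientRG

end
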